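import Summits.ValiantsHypothesis.ValiantsHypothesis.Theorems.NewtonTauWeak.Negative.AlignedPeelingBound

/-!
# `NewtonTauWeak` (stmt-5904), line `aligned-peeling` refuted — part 6: the aligned bound `V = 5` and the refutation
# `¬ ∃ C c, AlignedPeeling C c` (negative lane)

The series `Theorems/NewtonTauWeak/Negative/AlignedPeeling*.lean` refutes the load-bearing stub `stub_alignedPeeling`
(`∃ C c, AlignedPeeling C c`) of the registered line `aligned-peeling` of crux `NewtonTauWeak`
(stmt-ValiantsHypothesis-5904); see `AlignedPeelingSumset.lean` for the overview.  The LINE dies; the crux itself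
stays OPEN; nothing here bears on `VP ≠ VNP`.

Main results:
* `alignedBound_five : AlignedBound (gfam n) 5` — every aligned combination `d₀ X^(a₀) P + d₁ X^(a₁) · 1` of the design
  pair has at most `5` hull vertices (its support is a translate of the sumset with at most one point added or deleted);
* `not_alignedPeeling C c : ¬ AlignedPeeling C c` — instance `k = 2`, `t = 6`, `V = 5`, `n = 5C + 14^c + 1`: the stub would
  give `vert F ≤ 5C + 14^c` against `le_vert_desF : n ≤ vert F`;
* `not_exists_alignedPeeling : ¬ ∃ C c, AlignedPeeling C c` — VERBATIM the negation of the registered stub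
  `stub_alignedPeeling` of `Cruxes/NewtonTauWeak/Lines/aligned_peeling.lean` (over the landed Defs copy
  `Theorems/NewtonUnitEquationsNewtonTauWeakAlignedPeelingDefs.lean`).  The line `aligned-peeling` is dead; the crux
  `NewtonTauWeak` (KPTT's weak Newton-polygon τ-bound) remains OPEN.  [folklore]
-/

set_option linter.dupNamespace false

namespace Summit.ValiantsHypothesis.ValiantsHypothesis.Theorems.NewtonTauWeak.Negative.AlignedPeelingCex

open scoped BigOperators
open MvPolynomial Finset
open Summit.ValiantsHypothesis.ValiantsHypothesis.Theorems.NewtonTauWeak.Negative (vert)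

noncomputable section

/-! ## D.5 The aligned bound `V = 5` -/

/-- Support of a monomial multiple: the translate of the support. -/
theorem support_monomial_mul_eq_image (a₀ : Fin 2 →₀ ℕ) (d₀ : ℂ) (hd : d₀ ≠ 0) (P : MvPolynomial (Fin 2) ℂ) :
    (monomial a₀ d₀ * P).support = P.support.image (a₀ + ·) := by
  classical
  ext e
  rw [mem_support_iff, coeff_monomial_mul', Finset.mem_image]
  constructor
  · intro h
    by_cases hle : a₀ ≤ e
    · rw [if_pos hle] at h
      exact ⟨e - a₀, mem_support_iff.mpr (fun h0 => h (by rw [h0, mul_zero])), add_tsub_cancel_of_le hle⟩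
    · rw [if_neg hle] at h; exact absurd rfl h
  · rintro ⟨y, hy, rfl⟩
    rw [if_pos le_self_add, add_tsub_cancel_left]
    exact mul_ne_zero hd (mem_support_iff.mp hy)

/-- The candidate set after deleting summit `s`: two other summits, the guard, two edge neighbours (`≤ 5` points). -/
theorem card_candidates_le (n : ℕ) (s : Fin 3) :
    (((Finset.univ.erase s).image (summitPt n)) ∪ ({guardPt n s} ∪
      ((Finset.univ.erase s).image fun s' => n • corner (side n) s + corner (side n) s'))).card ≤ 5 := by
  classical
  have h3 : (Finset.univ.erase s).card = 2 := by
    rw [Finset.card_erase_of_mem (Finset.mem_univ _), Finset.card_univ, Fintype.card_fin]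
  calc _ ≤ ((Finset.univ.erase s).image (summitPt n)).card + ({guardPt n s} ∪
        ((Finset.univ.erase s).image fun s' => n • corner (side n) s + corner (side n) s')).card :=
        Finset.card_union_le _ _
    _ ≤ 2 + (1 + 2) := by
        gcongr
        · exact Finset.card_image_le.trans h3.le
        · exact (Finset.card_union_le _ _).trans (by
            gcongr
            · simp
            · exact Finset.card_image_le.trans h3.le)
    _ = 5 := by norm_num

/-- **The aligned bound.**  Every aligned combination `d₀ X^{a₀} P + d₁ X^{a₁} · 1` of the design pair has at most `5`
hull vertices. -/
theorem alignedBound_five (n : ℕ) (hn : 1 ≤ n) : AlignedPeeling.AlignedBound (gfam n) 5 := by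
  classical
  intro a d
  have hΦ : (∑ k, monomial (a k) (d k) * ∏ i, gfam n k i) =
      monomial (a 0) (d 0) * desP n + monomial (a 1) (d 1) := by
    rw [Fin.sum_univ_two]; simp [gfam, desP]
  rw [hΦ]
  set S := sumset (Tfam n) with hSdef
  set M := monomial (a 0) (d 0) * desP n with hMdef
  have hcoeff : ∀ e, coeff e (M + monomial (a 1) (d 1)) = if e = a 1 then coeff (a 1) M + d 1 else coeff e M := by
    intro e
    rw [coeff_add, coeff_monomial]
    by_cases h : e = a 1
    · subst h; simp
    · rw [if_neg (Ne.symm h), if_neg h, add_zero]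
  -- summits, translated
  set Sum3 := (Finset.univ.image (summitPt n)).image (a 0 + ·) with hSum3
  have hSum3card : Sum3.card ≤ 3 :=
    Finset.card_image_le.trans (Finset.card_image_le.trans (by simp))
  have hSum3mem : ∀ s, a 0 + summitPt n s ∈ Sum3 := fun s =>
    Finset.mem_image.mpr ⟨summitPt n s, Finset.mem_image.mpr ⟨s, Finset.mem_univ _, rfl⟩, rfl⟩
  by_cases hd0 : d 0 = 0
  · -- only the monomial survives
    refine (vert_le_card _ {a 1} fun ξ₀ ξ₁ e he => ?_).trans (by simp)
    have hmem := he.mem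
    have : M = 0 := by rw [hMdef, hd0, monomial_zero, zero_mul]
    rw [this, zero_add] at hmem
    exact support_monomial_subset hmem
  have hsuppM : M.support = S.image (a 0 + ·) := by
    rw [hMdef, support_monomial_mul_eq_image _ _ hd0, desP, support_prod_onesPoly]
  have hSdesP : (desP n).support = S := by rw [desP, support_prod_onesPoly]
  by_cases ha1 : a 1 ∈ M.support
  · obtain ⟨y₀, hy₀S, hy₀⟩ : ∃ y₀ ∈ S, a 0 + y₀ = a 1 := by
      simpa [hsuppM, Finset.mem_image] using ha1
    by_cases hγ : coeff (a 1) M + d 1 = 0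
    · -- the point `a 1 = a 0 + y₀` is cancelled: support = translate of `S.erase y₀`
      have hsupp : (M + monomial (a 1) (d 1)).support = (S.erase y₀).image (a 0 + ·) := by
        ext e
        rw [mem_support_iff, hcoeff]
        by_cases h : e = a 1
        · rw [if_pos h, h]
          simp only [hγ, ne_eq, not_true_eq_false, false_iff, Finset.mem_image, Finset.mem_erase, not_exists,
            not_and, and_imp]
          intro y hy _ hya
          exact hy (add_left_cancel (hya.trans hy₀.symm))
        · rw [if_neg h, ← mem_support_iff, hsuppM]
          simp only [Finset.mem_image, Finset.mem_erase]
          constructor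
          · rintro ⟨y, hy, rfl⟩
            exact ⟨y, ⟨fun hyy => h (by rw [hyy, hy₀]), hy⟩, rfl⟩
          · rintro ⟨y, ⟨_, hy⟩, rfl⟩
            exact ⟨y, hy, rfl⟩
      by_cases hys : ∃ s, y₀ = summitPt n s
      · obtain ⟨s, rfl⟩ := hys
        set K₀ := ((Finset.univ.erase s).image (summitPt n)) ∪ ({guardPt n s} ∪
          ((Finset.univ.erase s).image fun s' => n • corner (side n) s + corner (side n) s')) with hK₀
        refine (vert_le_card _ (K₀.image (a 0 + ·)) fun ξ₀ ξ₁ e he => ?_).trans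
          (Finset.card_image_le.trans (card_candidates_le n s))
        rw [hsupp] at he
        obtain ⟨y, _, rfl, hy⟩ := isUniqueMin_of_image_add ξ₀ ξ₁ _ _ _ he
        refine Finset.mem_image.mpr ⟨y, ?_, rfl⟩
        rcases isUniqueMin_erase_summit n hn s ξ₀ ξ₁ y hy with ⟨s', hs', rfl⟩ | rfl | ⟨s', hs', rfl⟩
        · exact Finset.mem_union_left _ (Finset.mem_image.mpr ⟨s', Finset.mem_erase.mpr ⟨hs', Finset.mem_univ _⟩, rfl⟩)
        · exact Finset.mem_union_right _ (Finset.mem_union_left _ (Finset.mem_singleton_self _))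
        · exact Finset.mem_union_right _ (Finset.mem_union_right _
            (Finset.mem_image.mpr ⟨s', Finset.mem_erase.mpr ⟨hs', Finset.mem_univ _⟩, rfl⟩))
      · push Not at hys
        refine (vert_le_card _ Sum3 fun ξ₀ ξ₁ e he => ?_).trans (hSum3card.trans (by norm_num))
        rw [hsupp] at he
        obtain ⟨y, _, rfl, hy⟩ := isUniqueMin_of_image_add ξ₀ ξ₁ _ _ _ he
        obtain ⟨s, rfl⟩ := summit_of_isUniqueMin_erase n ξ₀ ξ₁ y₀ y hy₀S hys hy
        exact hSum3mem s
    · -- the support is the full translate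
      have hsupp : (M + monomial (a 1) (d 1)).support = S.image (a 0 + ·) := by
        ext e
        rw [mem_support_iff, hcoeff, ← hsuppM]
        by_cases h : e = a 1
        · rw [if_pos h, h]; exact ⟨fun _ => ha1, fun _ => hγ⟩
        · rw [if_neg h, ← mem_support_iff]
      refine (vert_le_card _ Sum3 fun ξ₀ ξ₁ e he => ?_).trans (hSum3card.trans (by norm_num))
      rw [hsupp] at he
      obtain ⟨y, _, rfl, hy⟩ := isUniqueMin_of_image_add ξ₀ ξ₁ _ _ _ he
      obtain ⟨s, rfl⟩ := summit_of_isUniqueMin_sumset n ξ₀ ξ₁ y hy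
      exact hSum3mem s
  · -- `a 1` outside the translate: at most one extra point
    have hsub : M.support ⊆ (M + monomial (a 1) (d 1)).support := by
      intro e he
      have hne : e ≠ a 1 := fun h => ha1 (h ▸ he)
      rw [mem_support_iff, hcoeff, if_neg hne]
      exact mem_support_iff.mp he
    have hsup : (M + monomial (a 1) (d 1)).support ⊆ M.support ∪ {a 1} := by
      intro e he
      rw [Finset.mem_union, Finset.mem_singleton]
      by_cases h : e = a 1
      · exact Or.inr h
      · left
        rw [mem_support_iff, hcoeff, if_neg h] at he
        exact mem_support_iff.mpr he
    refine (vert_le_card _ (Sum3 ∪ {a 1}) fun ξ₀ ξ₁ e he => ?_).trans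
      ((Finset.card_union_le _ _).trans (by simp only [Finset.card_singleton]; omega))
    by_cases h : e = a 1
    · exact Finset.mem_union_right _ (Finset.mem_singleton.mpr h)
    · have heM : e ∈ M.support := by
        rcases Finset.mem_union.mp (hsup he.mem) with h' | h'
        · exact h'
        · exact absurd (Finset.mem_singleton.mp h') h
      have he' : IsUniqueMin ξ₀ ξ₁ M.support e := he.mono hsub heM
      rw [hsuppM] at he'
      obtain ⟨y, _, rfl, hy⟩ := isUniqueMin_of_image_add ξ₀ ξ₁ _ _ _ he'
      obtain ⟨s, rfl⟩ := summit_of_isUniqueMin_sumset n ξ₀ ξ₁ y hy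
      exact Finset.mem_union_left _ (hSum3mem s)

/-! ## E. The refutation -/

/-- **No constants work**: `AlignedPeeling C c` fails for every `C, c` (instance: the design with `n = 5C + 14^c + 1`,
`k = 2`, `t = 6`, `V = 5`). -/
theorem not_alignedPeeling (C c : ℕ) : ¬ AlignedPeeling.AlignedPeeling C c := by
  intro h
  have hpow : 1 ≤ 14 ^ c := Nat.one_le_pow _ _ (by norm_num)
  set n := 5 * C + 14 ^ c + 1 with hn
  have hn1 : 1 ≤ n := by omega
  have hb := h 2 (n + 1) 6 5 (gfam n) (pfam n) (card_support_gfam_le n) (card_support_pfam_le n)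
    (alignedBound_five n hn1)
  rw [sum_pfam_mul_prod] at hb
  have hl := le_vert_desF n
  have h14 : (2 * 6 + 2) ^ c = 14 ^ c := by norm_num
  rw [h14] at hb
  omega

/-- **Refutation of the line's load-bearing stub** `stub_alignedPeeling : ∃ C c, AlignedPeeling C c` (verbatim the
registered statement of line `aligned-peeling` of crux `NewtonTauWeak`, stmt-ValiantsHypothesis-5904, over the landed
Defs copy).  The crux itself is untouched. -/
theorem not_exists_alignedPeeling : ¬ ∃ C c : ℕ, AlignedPeeling.AlignedPeeling C c :=
  fun ⟨C, c, h⟩ => not_alignedPeeling C c h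

end

end Summit.ValiantsHypothesis.ValiantsHypothesis.Theorems.NewtonTauWeak.Negative.AlignedPeelingCex
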